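import Mathlib
import Summits.ValiantsHypothesis.ValiantsHypothesis.Theorems.KPlusLogSqLawWeakLiftingTowerGraftSignedCrossingAsymptotic

/-!
# Tower graft line — SIGNED CROSSINGS XII: the MATRIX INTERMEDIATE VALUE THEOREM — lower bounds for the positive roots of a symmetric
# exponent family from the inertia of its extreme letters

Structure file for LINE (B) `Cruxes/WeakLifting/Lines/tower_graft.lean` (crux `WeakLifting` = stmt-ValiantsHypothesis-19561),
twelfth of the SIGNED-CROSSING series, CONSTRUCTION side.  The scalar certificate «`det` changes sign between `a` and `b` ⇒ a root in
`(a, b)`» only sees the PARITY of `ν₋`.  The flux laws give the full inertia version, with no transversality assumption at all: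
for a real symmetric exponent family `H u = Σ_l u^{e_l}•T_l`,

§1 `finite_roots_family_of_det_ne_zero` (one non-root ⇒ the roots in `(a, b)` are finite: the determinant polynomial is not `0`),
   ★ `negCount_dist_le_sum_zeroCount_family` — for non-roots `a ≤ b`: `|ν₋(H a) − ν₋(H b)| ≤ Σ_{roots t ∈ (a, b)} ν₀(H t)` (kernel multiplicities),
   ★ `negCount_dist_le_card_mul` — hence `|ν₋(H a) − ν₋(H b)| ≤ |ι| · #{distinct roots of det in (a, b)}`: a zone across which the negative
   inertia changes by `Δ` contains at least `⌈Δ/|ι|⌉` distinct roots (`Δ` odd or even alike).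
§2 ★★ `negCount_dist_extreme_le_card_mul` — MATRIX IVT FROM THE EXTREME LETTERS: strictly lowest exponent `e_{l₀}`, strictly highest `e_{l₁}`,
   `T_{l₀}`, `T_{l₁}` nonsingular ⇒ `|ν₋(T_{l₀}) − ν₋(T_{l₁})| ≤ |ι| · #{distinct positive roots of det (Σ_l X^{e_l}•T_l)}`; e.g. any symmetric pencil
   from `−1` (lowest) to `+1` (highest) has a positive root for EVERY size, where the determinant sign sees it only for odd sizes.
READING FOR THE LINE (honest): a census-side instrument (lower bounds for `ζ`-type rows from inertia data at two letters); it certifies roots, it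
bounds nothing from above; no census row is moved here.  Zero stub credit; S4/S5, TowerB, WeakLifting, Conjecture B, 18050, VP ≠ VNP untouched.
Def-free; Mathlib + files I–XI.  Seat: prover val-sym-lift-p2 g24, `--supports stmt-ValiantsHypothesis-19561 --as helper`.
[folklore: inertia/spectral-flow lower bounds; the packaging for the line is this work]
-/

-- `Summit.ValiantsHypothesis.ValiantsHypothesis.…` repeats a component by the D-0017 layout
-- (single-conjunct summit), which the `dupNamespace` linter flags; the name is mandated.
set_option linter.dupNamespace false
set_option autoImplicit false

namespace Summit.ValiantsHypothesis.ValiantsHypothesis.Theorems.KPlusLogSqLaw.TowerGraft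

open Matrix Finset Filter Polynomial
open scoped BigOperators Topology

namespace SignedCrossing

variable {ι : Type} [Fintype ι] [DecidableEq ι] {κ : Type} [Fintype κ] [DecidableEq κ]

/-! ## §1 Inertia change forces roots -/

omit [DecidableEq κ] in
/-- one non-root ⇒ the determinant polynomial is nonzero ⇒ the roots in `(a, b)` form a finite set. [folklore] -/
theorem finite_roots_family_of_det_ne_zero (e : κ → ℕ) (Tm : κ → Matrix ι ι ℝ) {u₀ : ℝ} (hu₀ : (∑ l, (u₀ ^ e l) • Tm l).det ≠ 0) (a b : ℝ) :
    {u : ℝ | a < u ∧ u < b ∧ (∑ l, (u ^ e l) • Tm l).det = 0}.Finite := by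
  classical
  set f : ℝ[X] := (∑ l, (X : ℝ[X]) ^ e l • (Tm l).map C).det with hf
  have heval : ∀ u : ℝ, f.eval u = (∑ l, (u ^ e l) • Tm l).det := fun u => TowerEscape.eval_det_pencil' Tm e u
  have hf0 : f ≠ 0 := fun h0 => hu₀ (by rw [← heval, h0, eval_zero])
  refine (f.roots.toFinset.finite_toSet).subset fun u hu => ?_
  rw [Set.mem_setOf_eq] at hu
  rw [Finset.mem_coe, Multiset.mem_toFinset, Polynomial.mem_roots hf0, Polynomial.IsRoot.def, heval]
  exact hu.2.2

omit [DecidableEq κ] in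
/-- **inertia change forces kernel mass**: for non-roots `a ≤ b` of a symmetric exponent family, the negative inertia changes across `[a, b]` by at
most the total kernel multiplicity of the roots in between: `ν₋(b) ≤ Σ ν₀ + ν₋(a)` and `ν₋(a) ≤ Σ ν₀ + ν₋(b)` (the sum over any `Set.Finite`
witness of the root set, e.g. `finite_roots_family_of_det_ne_zero`). [this work] -/
theorem negCount_dist_le_sum_zeroCount_family (e : κ → ℕ) (Tm : κ → Matrix ι ι ℝ) (hTm : ∀ l, (Tm l).IsSymm) {a b : ℝ} (hab : a ≤ b)
    (ha0 : (∑ l, (a ^ e l) • Tm l).det ≠ 0) (hb0 : (∑ l, (b ^ e l) • Tm l).det ≠ 0)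
    (hfin : {u : ℝ | a < u ∧ u < b ∧ (∑ l, (u ^ e l) • Tm l).det = 0}.Finite) :
    (univ.filter fun i => (SteepZone.isHermitian_family (fun l => b ^ e l) Tm hTm).eigenvalues i < 0).card ≤
        (∑ t ∈ hfin.toFinset, (univ.filter fun i => (SteepZone.isHermitian_family (fun l => t ^ e l) Tm hTm).eigenvalues i = 0).card) +
          (univ.filter fun i => (SteepZone.isHermitian_family (fun l => a ^ e l) Tm hTm).eigenvalues i < 0).card ∧
      (univ.filter fun i => (SteepZone.isHermitian_family (fun l => a ^ e l) Tm hTm).eigenvalues i < 0).card ≤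
        (∑ t ∈ hfin.toFinset, (univ.filter fun i => (SteepZone.isHermitian_family (fun l => t ^ e l) Tm hTm).eigenvalues i = 0).card) +
          (univ.filter fun i => (SteepZone.isHermitian_family (fun l => b ^ e l) Tm hTm).eigenvalues i < 0).card :=
  negCount_dist_le_sum_zeroCount (fun u => ∑ l, (u ^ e l) • Tm l) (fun u => ∑ l, ((e l : ℝ) * u ^ (e l - 1)) • Tm l)
    (fun u => SteepZone.isHermitian_family (fun l => u ^ e l) Tm hTm) (fun u _ _ i j => hasDerivAt_family e Tm u i j) hab ha0 hb0
    hfin.toFinset (fun _ ht => ⟨((Set.Finite.mem_toFinset hfin).mp ht).1, ((Set.Finite.mem_toFinset hfin).mp ht).2.1⟩)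
    fun _ hu1 hu2 h0 => (Set.Finite.mem_toFinset hfin).mpr ⟨hu1, hu2, h0⟩

omit [DecidableEq κ] in
/-- kernel multiplicity is at most the size. [folklore] -/
theorem zeroCount_le_card {A : Matrix ι ι ℝ} (hA : A.IsHermitian) : (univ.filter fun i => hA.eigenvalues i = 0).card ≤ Fintype.card ι :=
  (Finset.card_filter_le _ _).trans (by simp)

omit [DecidableEq κ] in
/-- **inertia change forces distinct roots**: `|ν₋(H a) − ν₋(H b)| ≤ |ι| · #{distinct roots of det H in (a, b)}` for non-roots `a ≤ b`. [this work] -/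
theorem negCount_dist_le_card_mul (e : κ → ℕ) (Tm : κ → Matrix ι ι ℝ) (hTm : ∀ l, (Tm l).IsSymm) {a b : ℝ} (hab : a ≤ b)
    (ha0 : (∑ l, (a ^ e l) • Tm l).det ≠ 0) (hb0 : (∑ l, (b ^ e l) • Tm l).det ≠ 0)
    (hfin : {u : ℝ | a < u ∧ u < b ∧ (∑ l, (u ^ e l) • Tm l).det = 0}.Finite) :
    (univ.filter fun i => (SteepZone.isHermitian_family (fun l => b ^ e l) Tm hTm).eigenvalues i < 0).card ≤
        Fintype.card ι * hfin.toFinset.card + (univ.filter fun i => (SteepZone.isHermitian_family (fun l => a ^ e l) Tm hTm).eigenvalues i < 0).card ∧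
      (univ.filter fun i => (SteepZone.isHermitian_family (fun l => a ^ e l) Tm hTm).eigenvalues i < 0).card ≤
        Fintype.card ι * hfin.toFinset.card + (univ.filter fun i => (SteepZone.isHermitian_family (fun l => b ^ e l) Tm hTm).eigenvalues i < 0).card := by
  have h := negCount_dist_le_sum_zeroCount_family e Tm hTm hab ha0 hb0 hfin
  have hbound : (∑ t ∈ hfin.toFinset, (univ.filter fun i => (SteepZone.isHermitian_family (fun l => t ^ e l) Tm hTm).eigenvalues i = 0).card) ≤
      Fintype.card ι * hfin.toFinset.card := by
    rw [mul_comm, Finset.card_eq_sum_ones, Finset.sum_mul, one_mul]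
    exact Finset.sum_le_sum fun t _ => zeroCount_le_card _
  constructor <;> omega

/-! ## §2 The matrix IVT from the extreme letters -/

/-- **MATRIX IVT FROM THE EXTREME LETTERS.**  `H u = Σ_l u^{e_l}•T_l`, symmetric letters, `e_{l₀} < e_l` for `l ≠ l₀`, `e_l < e_{l₁}` for `l ≠ l₁`,
`T_{l₀}` and `T_{l₁}` nonsingular (with Hermitian witnesses `h₀`, `h₁`).  Then the distinct positive roots of `det (Σ_l X^{e_l}•T_l)` number at least
`|ν₋(T_{l₀}) − ν₋(T_{l₁})| / |ι|`:  `ν₋(T_{l₁}) ≤ |ι|·#roots + ν₋(T_{l₀})` and `ν₋(T_{l₀}) ≤ |ι|·#roots + ν₋(T_{l₁})`. [this work] -/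
theorem negCount_dist_extreme_le_card_mul (e : κ → ℕ) (Tm : κ → Matrix ι ι ℝ) (hTm : ∀ l, (Tm l).IsSymm) (l₀ l₁ : κ)
    (hbot : ∀ l, l ≠ l₀ → e l₀ < e l) (htop : ∀ l, l ≠ l₁ → e l < e l₁)
    (h₀ : (Tm l₀).IsHermitian) (hdet₀ : (Tm l₀).det ≠ 0) (h₁ : (Tm l₁).IsHermitian) (hdet₁ : (Tm l₁).det ≠ 0) :
    (univ.filter fun i => h₁.eigenvalues i < 0).card ≤
        Fintype.card ι * ((∑ l, (X : ℝ[X]) ^ e l • (Tm l).map C).det.roots.toFinset.filter (fun t => 0 < t)).card +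
          (univ.filter fun i => h₀.eigenvalues i < 0).card ∧
      (univ.filter fun i => h₀.eigenvalues i < 0).card ≤
        Fintype.card ι * ((∑ l, (X : ℝ[X]) ^ e l • (Tm l).map C).det.roots.toFinset.filter (fun t => 0 < t)).card +
          (univ.filter fun i => h₁.eigenvalues i < 0).card := by
  classical
  obtain ⟨u₁, hu₁, htopu⟩ := exists_inertia_eq_top e Tm hTm l₁ htop hdet₁
  obtain ⟨u₀, hu₀, hbotu⟩ := exists_inertia_eq_bottom e Tm hTm l₀ hbot hdet₀
  -- the zone `[a, b]` with `a = min u₀ u₁`, `b = max u₀ u₁`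
  set a : ℝ := min u₀ u₁ with ha
  set b : ℝ := max u₀ u₁ with hb
  have ha0' : 0 < a := lt_min hu₀ hu₁
  have hab : a ≤ b := min_le_max
  obtain ⟨hda, hνa, -⟩ := hbotu a ha0' (min_le_left _ _)
  obtain ⟨hdb, hνb, -⟩ := htopu b (le_max_right _ _)
  have hone0 : (∑ _l : Unit, (1 : ℝ) • Tm l₀) = Tm l₀ := by simp
  have hone1 : (∑ _l : Unit, (1 : ℝ) • Tm l₁) = Tm l₁ := by simp
  rw [negCount_congr _ h₀ hone0 (fun x => x < 0)] at hνa
  rw [negCount_congr _ h₁ hone1 (fun x => x < 0)] at hνb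
  have hfin := finite_roots_family_of_det_ne_zero e Tm hda a b
  have h := negCount_dist_le_card_mul e Tm hTm hab hda hdb hfin
  rw [hνa, hνb] at h
  -- the roots in `(a, b)` are among the positive roots of the determinant polynomial
  set f : ℝ[X] := (∑ l, (X : ℝ[X]) ^ e l • (Tm l).map C).det with hf
  have heval : ∀ u : ℝ, f.eval u = (∑ l, (u ^ e l) • Tm l).det := fun u => TowerEscape.eval_det_pencil' Tm e u
  have hf0 : f ≠ 0 := fun h0 => hda (by rw [← heval, h0, eval_zero])
  have hsub : hfin.toFinset ⊆ f.roots.toFinset.filter (fun t => 0 < t) := by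
    intro t ht
    have ht' := (Set.Finite.mem_toFinset hfin).mp ht
    rw [Finset.mem_filter, Multiset.mem_toFinset, Polynomial.mem_roots hf0, Polynomial.IsRoot.def, heval]
    exact ⟨ht'.2.2, ha0'.trans ht'.1⟩
  have hcard := Finset.card_le_card hsub
  have hmono : Fintype.card ι * hfin.toFinset.card ≤ Fintype.card ι * (f.roots.toFinset.filter (fun t => 0 < t)).card :=
    Nat.mul_le_mul_left _ hcard
  constructor <;> omega

end SignedCrossing

end Summit.ValiantsHypothesis.ValiantsHypothesis.Theorems.KPlusLogSqLaw.TowerGraft
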